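import Literature.NumberTheory.EllipticCurves.TianYuanZhang2017.UPlusOfGenusPointData
import Summits.BirchSwinnertonDyer.Rank1Residual.P2.CongruentNumberLevelTwoDoor
import HarnessLib

/-!
# WORKFILE (crux stmt-BirchSwinnertonDyer-20509, line `offtyz-v7`, LEAD cruxlead-20509 g0) — the LEVEL-TWO LAW ON THE
# R1 SECTOR IN GENUS CURRENCY: two CONJECTURAL statements (census-backed, NOT theorems, NOT Literature facts) and the
# proved composition «both ⟹ C⁺ on the sector»

Status: CONJECTURES typed for the ideator / disprover / next lead; `def … : Prop` only because this is a crux WORKFILE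
(`Cruxes/RamifiedOffTYZOfFacts/Lines/`), never a Theorems/Literature proposal. Nothing here is asserted.

R1 sector of category D of the congruent-number residual: `n = l·m`, `l ≡ 1 (mod 8)` and `m ≡ 5 (mod 8)` primes, `(l/m) = +1`
(then `s(n) = 3`, `#Sel₂(E_n) = 2⁵`). LEAD instrument (folder `instruments/level2_genus*.py`, local python; `g(d) = #2Cl(ℚ(√−d))`
from reduced-form class numbers; census kit j299242 labels G = Cassels–Tate jump one / B = not, n ≤ 10⁵):

* **K1″-CT (876/876, 0 exceptions):**  B ⟺ `4 ∣ g(l)` ∧ `4 ∣ g(lm)` ∧ `(l/m)₄ = +1`.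
  Dictionary with planner g6's symbol law R1 («B ⟺ (p/q)₄ = (q/p)₄ = +1 ∧ (2/ℓ)₄(ℓ/2)₄ = +1»): `4 ∣ g(l) ⟺ (2/l)₄(l/2)₄ = +1`
  (Barrucand–Cohn, `8 ∣ h(−4l) ⟺ l = x² + 32y²`; checked 876/876) and `4 ∣ g(lm) ⟺ (m/l)₄ = +1` (checked 876/876); the third bit
  `(l/m)₄` is NOT a function of `g(d) mod 4`, `d ∈ {l, m, lm, 2l, 2m, 2lm}` (it is the Scholz symbol `(l/m)₄(m/l)₄ = (ε_l/m)` once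
  `(m/l)₄ = +1`, a datum of the REAL fields). So the Cassels–Tate jump on R1 is «TYZ's genus weights read MOD 4» plus ONE Scholz symbol.
* **K1″-𝓛 (the analytic side; direct Ш_an check n ≤ 2·10⁴: 388 G with Ш_an = 4, 14 B-rank-1 with Ш_an = 16, kit j300539; n ≤ 10⁵ via
  K1″-CT + BSD):** on R1 ∩ {r_an = 1}:  `2 ∥ 𝓛(lm)` ⟺ ¬(`4 ∣ g(l)` ∧ `4 ∣ g(lm)` ∧ `(l/m)₄ = +1`), and `4 ∣ 𝓛(lm)` otherwise.
* Why this is the «mod-4 reading of the recursion»: on R1 the TYZ recursion is `P(lm) = Z(lm) − ε·𝓛(l)·Z(m)` (`recursionIndex (lm) = {m}`,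
  `Z(m) = P(m)`, `m` a Heegner prime with `𝓛(m)` odd), and the PRINTED rank-zero level-2 law for the coefficient is Zhao 2001 Thm 1 (k = 1,
  via Rhoades 2009 arXiv:0706.4344 Thm 6.6) + Barrucand–Cohn: `4 ∣ 𝓛(l) ⟺ δ(l) = 0 ⟺ (2/l)₄(l/2)₄ = +1 ⟺ 4 ∣ g(l)` — i.e. the first bit
  of K1″ is exactly «the correction term `ε𝓛(l)Z(m)` vanishes modulo 4A». The second bit `4 ∣ g(lm)` is the count of `Z(lm)`'s terms modulo 4
  (`Z(lm) = Tr_{2Cl/4Cl} Z₄(lm)`, `#2Cl = g(lm)`); the third is the Gaussian (quartic) genus character the level-2 display must produce.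
  (acq-14171 filed for Zhao's primary text.)
* R2 sector (`m ≡ 7 (mod 8)`) and the even sector: NO law in `g(d) mod 4` (`d ∣ 2n`) + quartic symbols — 2 mixed classes per sub-type;
  planner g6's extra bit there is the 2-part of the REAL class group `Cl(ℚ(√lm))` (narrow genus theory), consistent with the Scholz bit here.

BSD is not proved by any of this; no class is closed by this file.
-/

noncomputable section

open scoped Classical

open WeierstrassCurve Literature.NumberTheory.EllipticCurves Literature.NumberTheory.EllipticCurves.Rank1Residual
  Literature.NumberTheory.EllipticCurves.TianYuanZhang2017 Literature.NumberTheory.EllipticCurves.TianYuanZhang2017.W2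
  Summit.BirchSwinnertonDyer.Rank1Residual

set_option autoImplicit false

namespace Summit.BirchSwinnertonDyer.PrintCf2.LevelTwo.Sketch

/-- The R1 sector: `l ≡ 1 (mod 8)`, `m ≡ 5 (mod 8)` primes with `l` a quadratic residue mod `m`. -/
def R1Sector (l m : ℕ) : Prop :=
  l.Prime ∧ m.Prime ∧ l % 8 = 1 ∧ m % 8 = 5 ∧ ∃ x : ZMod m, x ^ 2 = (l : ZMod m)

/-- The level-two genus predicate of K1″: `4 ∣ g(l)`, `4 ∣ g(lm)` (`g = gK = #2Cl(ℚ(√−d))` read in `GenusField d`) and `l` is a QUARTIC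
residue mod `m` (`(l/m)₄ = +1`). -/
def R1Deep (l m : ℕ) : Prop :=
  4 ∣ gK l ∧ 4 ∣ gK (l * m) ∧ ∃ x : ZMod m, x ^ 4 = (l : ZMod m)

/-- **CONJECTURE K1″-CT** (census 876/876): on the R1 sector (with `s = 3`), the Cassels–Tate jump-one condition `#Sel₄(E_{lm}) = 2⁶`
holds iff NOT `R1Deep l m`. A 4-descent / Rédei-matrix statement (support-grade, no L-function). -/
def LevelTwoJumpLawR1 : Prop :=
  ∀ (l m : ℕ), R1Sector l m →
    Nat.card ((congruentNumberCurve (l * m)).selmerGroup 2) = 2 ^ 5 →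
    (Nat.card ((congruentNumberCurve (l * m)).selmerGroup 4) = 2 ^ 6 ↔ ¬ R1Deep l m)

/-- **CONJECTURE K1″-𝓛** (the level-two genus FORMULA for `𝓛` on R1 ∩ {r_an = 1}): `2 ∥ 𝓛(lm)` iff NOT `R1Deep l m`.
Beyond print (the rank-one analogue of Zhao's second-lowest-2-power criterion). -/
def LevelTwoGenusFormulaR1 : Prop :=
  ∀ (l m : ℕ) [(congruentNumberCurve (l * m)).IsElliptic], R1Sector l m →
    (congruentNumberCurve (l * m)).analyticRank = 1 →
    Nat.card ((congruentNumberCurve (l * m)).selmerGroup 2) = 2 ^ 5 →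
    ∀ L : ℤ, IsScriptL (l * m) L → (((2 : ℤ) ∣ L ∧ ¬ (4 : ℤ) ∣ L) ↔ ¬ R1Deep l m)

/-- **The two conjectures give C⁺ (`stub_offTYZ_levelTwoScriptLExact`) on the R1 sector** — real proof, pure logic: the jump law turns
`#Sel₄ = 2⁶` into `¬ R1Deep`, the genus formula turns `¬ R1Deep` into `2 ∥ 𝓛`. -/
theorem levelTwoScriptLExact_onR1_of (hJ : LevelTwoJumpLawR1) (hF : LevelTwoGenusFormulaR1)
    (l m : ℕ) [(congruentNumberCurve (l * m)).IsElliptic] (hS : R1Sector l m)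
    (hr : (congruentNumberCurve (l * m)).analyticRank = 1)
    (hS₂ : Nat.card ((congruentNumberCurve (l * m)).selmerGroup 2) = 2 ^ 5)
    (hS₄ : Nat.card ((congruentNumberCurve (l * m)).selmerGroup 4) = 2 ^ 6)
    (L : ℤ) (hL : IsScriptL (l * m) L) : (2 : ℤ) ∣ L ∧ ¬ (4 : ℤ) ∣ L :=
  (hF l m hS hr hS₂ L hL).mpr ((hJ l m hS hS₂).mp hS₄)

/-- **And conversely on R1 ∩ {r_an = 1}: K1″-𝓛 predicts `4 ∣ 𝓛(lm)` exactly on the deep (non-jump) members** (the B-locus of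
rank one: Ш(E_{lm})[2^∞] ⊋ Ш[2]; census Ш_an = 16 on 14/14). -/
theorem four_dvd_scriptL_onR1_of (hF : LevelTwoGenusFormulaR1)
    (l m : ℕ) [(congruentNumberCurve (l * m)).IsElliptic] (hS : R1Sector l m)
    (hr : (congruentNumberCurve (l * m)).analyticRank = 1)
    (hS₂ : Nat.card ((congruentNumberCurve (l * m)).selmerGroup 2) = 2 ^ 5)
    (hdeep : R1Deep l m) (L : ℤ) (hL : IsScriptL (l * m) L) (h2 : (2 : ℤ) ∣ L) : (4 : ℤ) ∣ L := by
  by_contra h4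
  exact ((hF l m hS hr hS₂ L hL).mp ⟨h2, h4⟩) hdeep

end Summit.BirchSwinnertonDyer.PrintCf2.LevelTwo.Sketch

end
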